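import Summits.ValiantsHypothesis.ValiantsHypothesis.Theorems.KPlusLogSqLawTropicalBCoupledRegistersStates

/-!
# Route `KPlusLogSqLaw`, crux `TropicalB` — the COUPLED-REGISTER family, part 3: rigidity, the dominant chain, the census row
# `TropRootLawAtStatic (2N+1) 3 B → N² + 2N ≤ B`

HONEST FRAMING.  Helper toward the registered stubs of `Cruxes/TropicalB/Lines/birth.lean` (crux
`Summit.ValiantsHypothesis.ValiantsHypothesis.Theses.KPlusLogSqLaw.TropicalB`, ledger item `stmt-ValiantsHypothesis-19771`,
route `KPlusLogSqLaw`; cell `pub-symmetroid`, seat val-sym-trop-p5 (g3), refuter-adjacent lane, 2026-08-26).  A LOWER-BOUND row at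
`K = 3` (quadratic in the size, as counting predicts); it says nothing about `TropicalB` in its window, about `WeakLifting`,
`KPlusLogSqLaw`, `MatrixDescartes` (stmt-ValiantsHypothesis-18050) or VP ≠ VNP.  Design and states: part 1 (`…CoupledRegistersDefs`);
entries / slope / valuation of a state: part 2 (`…CoupledRegistersStates`).

RESULTS.
* `CoupledRegister.rigid` — RIGIDITY: every present term of the design is one of the `(N+1)²` states (pigeonhole for the unique
  coupling column, then four «domino» inductions along the two registers);
* `CoupledRegister.exists_dominant_chain`, `CoupledRegister.chain_alternates` — the chain `k ↦ σ_{k/(N+1), k%(N+1)}` has slopes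
  `0, 1, …, (N+1)² − 1`, valuations `k²` and term signs `(−1)^k`, so val-sym-trop-p4's PARABOLA CRITERION (`isDominant_of_parabola`,
  …TropicalBParabolaCriterion; gap `G = 1`, depth `D = 1` — vacuous by rigidity) makes every chain term the unique optimum at an
  explicit integer slope;
* `CoupledRegister.not_tropRootLawAt` / `CoupledRegister.not_tropRootLawAtStatic` — `¬ TropRootLawAt (2N+1) 3 B` and
  `¬ TropRootLawAtStatic (2N+1) 3 B` for every `B < N² + 2N`;
* `sq_le_of_tropRootLawAtStatic_coupledRegister` — **`TropRootLawAtStatic (2N+1) 3 B → N² + 2N ≤ B`**: the STATIC `K = 3`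
  capacity at odd size `M` is at least `((M+1)/2)² − 1 ≈ M²/4` (the tree's static row so far, `…TropicalBStaticThree` via the port
  embedding of SHIFT-THREE, gives `≈ M²/18`; slope counting caps both at `C(M+2,2) − 1 ≈ M²/2`); `sq_le_of_tropRootLawAt_coupledRegister`
  is the same for the general row (`TropRootLawAt`, δ-equal to the birth file's `TropRow`).
Mechanism note (docstring only): no class is ever switched at a fixed entry and every step changes the permutation (a 4-cycle inside
a sweep of `t`, a long carry at `t = N → 0`); the bilinear «drift» `j·t` sits on the `(N+1)²` coupling entries, one per state — unit
capacity of the port `X_j`, which is why the construction does not extend to three registers (memo READS-AND-RESETS §3).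
[folklore] (hole registers; parabola heights).
-/

set_option linter.dupNamespace false
set_option autoImplicit false

namespace Summit.ValiantsHypothesis.ValiantsHypothesis.Theorems.KPlusLogSqLaw

open Summit.ValiantsHypothesis.ValiantsHypothesis.Theorems.MatrixDescartes.Negative
open Summit.ValiantsHypothesis.ValiantsHypothesis.Theorems.LacunarySymmetroidMatrixDescartes
open Summit.ValiantsHypothesis.ValiantsHypothesis.Theorems.LacunarySymmetroidMatrixDescartes.TropicalCensus
open Finset

namespace CoupledRegister

variable (N : ℕ)

/-! ## 5. Rigidity: every present term is a state -/

/-- a nonzero sign entry lies in the support. -/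
theorem inSupp_of_ε_ne_zero {a b : Fin (2 * N + 1)} {l : Fin 3} (h : ε N a b l ≠ 0) : InSupp N a b l := by
  unfold ε at h
  unfold InSupp
  split_ifs at h <;> simp_all

/-- columns of a present term lie in the support. -/
theorem inSupp_of_termSign_ne_zero {q : Equiv.Perm (Fin (2 * N + 1)) × (Fin (2 * N + 1) → Fin 3)}
    (hq : termSign (ε N) q ≠ 0) (b : Fin (2 * N + 1)) : InSupp N (q.1 b) b (q.2 b) := by
  unfold termSign at hq
  have h := (mul_ne_zero_iff.mp hq).2
  rw [Finset.prod_ne_zero_iff] at h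
  exact inSupp_of_ε_ne_zero N (h b (Finset.mem_univ b))

section Rigid

variable {N}
variable (σ : Equiv.Perm (Fin (2 * N + 1))) (lam : Fin (2 * N + 1) → Fin 3)
  (hs : ∀ b, InSupp N (σ b) b (lam b))
include hs

/-- c-columns go to X-rows. -/
theorem row_le_of_col_gt (b : Fin (2 * N + 1)) (hb : N < (b : ℕ)) : ((σ b : Fin (2 * N + 1)) : ℕ) ≤ N := by
  rcases hs b with h | h | h <;> omega

omit hs in
/-- there is an x-column matched into the X-rows (a coupling column). -/
theorem exists_coupling : ∃ t : Fin (2 * N + 1), (t : ℕ) ≤ N ∧ ((σ t : Fin (2 * N + 1)) : ℕ) ≤ N := by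
  by_contra hcon
  push Not at hcon
  -- then `σ` maps the `N+1` x-columns injectively into the `N` R-rows
  have hmap : ∀ b ∈ (univ.filter fun i : Fin (2 * N + 1) => 0 ≤ (i : ℕ) ∧ (i : ℕ) < N + 1),
      σ b ∈ (univ.filter fun i : Fin (2 * N + 1) => N + 1 ≤ (i : ℕ) ∧ (i : ℕ) < 2 * N + 1) := by
    intro b hb
    simp only [Finset.mem_filter, Finset.mem_univ, true_and] at hb ⊢
    have := hcon b (by omega)
    exact ⟨by omega, (σ b).isLt⟩
  have hinj : Set.InjOn σ (univ.filter fun i : Fin (2 * N + 1) => 0 ≤ (i : ℕ) ∧ (i : ℕ) < N + 1) :=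
    fun a _ b _ hab => σ.injective hab
  have := Finset.card_le_card_of_injOn σ hmap hinj
  rw [card_filter_val_Ico 0 (N + 1) (by omega), card_filter_val_Ico (N + 1) (2 * N + 1) le_rfl] at this
  omega

/-- the coupling column is unique. -/
theorem coupling_unique {t₁ t₂ : Fin (2 * N + 1)} (h₁ : (t₁ : ℕ) ≤ N) (h₁' : ((σ t₁ : Fin (2 * N + 1)) : ℕ) ≤ N)
    (h₂ : (t₂ : ℕ) ≤ N) (h₂' : ((σ t₂ : Fin (2 * N + 1)) : ℕ) ≤ N) : t₁ = t₂ := by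
  by_contra hne
  -- the c-columns together with `t₁, t₂` map injectively into the `N+1` X-rows
  let S : Finset (Fin (2 * N + 1)) :=
    (univ.filter fun i : Fin (2 * N + 1) => N + 1 ≤ (i : ℕ) ∧ (i : ℕ) < 2 * N + 1) ∪ {t₁, t₂}
  have hmap : ∀ b ∈ S, σ b ∈ (univ.filter fun i : Fin (2 * N + 1) => 0 ≤ (i : ℕ) ∧ (i : ℕ) < N + 1) := by
    intro b hb
    simp only [S, Finset.mem_union, Finset.mem_filter, Finset.mem_univ, true_and, Finset.mem_insert,
      Finset.mem_singleton] at hb ⊢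
    rcases hb with hb | rfl | rfl
    · have := row_le_of_col_gt σ lam hs b (by omega)
      exact ⟨by omega, by omega⟩
    · exact ⟨by omega, by omega⟩
    · exact ⟨by omega, by omega⟩
  have hinj : Set.InjOn σ S := fun a _ b _ hab => σ.injective hab
  have hle := Finset.card_le_card_of_injOn σ hmap hinj
  have hdisj : Disjoint (univ.filter fun i : Fin (2 * N + 1) => N + 1 ≤ (i : ℕ) ∧ (i : ℕ) < 2 * N + 1) {t₁, t₂} := by
    rw [Finset.disjoint_left]
    intro b hb hb'
    simp only [Finset.mem_filter, Finset.mem_univ, true_and] at hb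
    simp only [Finset.mem_insert, Finset.mem_singleton] at hb'
    rcases hb' with rfl | rfl <;> omega
  have hS : S.card = N + 2 := by
    simp only [S]
    rw [Finset.card_union_of_disjoint hdisj, card_filter_val_Ico (N + 1) (2 * N + 1) le_rfl,
      Finset.card_pair hne]
    omega
  rw [hS, card_filter_val_Ico 0 (N + 1) (by omega)] at hle
  omega

variable {σ lam}
variable {t₀ : Fin (2 * N + 1)} (ht₀ : (t₀ : ℕ) ≤ N) (hj₀ : ((σ t₀ : Fin (2 * N + 1)) : ℕ) ≤ N)
include ht₀ hj₀

/-- x-columns left of the coupling column are shifted (R-row `N+b+1`, class `1`). -/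
theorem left_of_coupling : ∀ (n : ℕ) (b : Fin (2 * N + 1)), (b : ℕ) = n → n < (t₀ : ℕ) →
    ((σ b : Fin (2 * N + 1)) : ℕ) = N + n + 1 ∧ lam b = 1 := by
  intro n
  induction n with
  | zero =>
    intro b hb hlt
    rcases hs b with h | h | h
    · exact absurd (coupling_unique σ lam hs (by omega) h.1 ht₀ hj₀) (fun e => by subst e; omega)
    · omega
    · rcases h with ⟨h1, _, h3 | h3⟩
      · omega
      · exact ⟨by omega, h3.2⟩
  | succ n ih =>
    intro b hb hlt
    have hprev := ih ⟨n, by omega⟩ rfl (by omega)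
    rcases hs b with h | h | h
    · exact absurd (coupling_unique σ lam hs (by omega) h.1 ht₀ hj₀) (fun e => by subst e; omega)
    · omega
    · rcases h with ⟨h1, _, h3 | h3⟩
      · -- `σ b = N + n + 1 = σ ⟨n⟩`: contradicts injectivity
        exfalso
        have heq : σ b = σ ⟨n, by omega⟩ := Fin.ext (by omega)
        have := congrArg Fin.val (σ.injective heq)
        simp only at this
        omega
      · exact ⟨by omega, h3.2⟩

/-- x-columns right of the coupling column are unshifted (R-row `N+b`, class `0`). -/
theorem right_of_coupling : ∀ (k : ℕ) (b : Fin (2 * N + 1)), (b : ℕ) + k = N → (t₀ : ℕ) < (b : ℕ) →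
    ((σ b : Fin (2 * N + 1)) : ℕ) = N + b ∧ lam b = 0 := by
  intro k
  induction k with
  | zero =>
    intro b hb hlt
    rcases hs b with h | h | h
    · exact absurd (coupling_unique σ lam hs (by omega) h.1 ht₀ hj₀) (fun e => by subst e; omega)
    · omega
    · rcases h with ⟨h1, _, h3 | h3⟩
      · exact ⟨by omega, h3.2⟩
      · have := (σ b).isLt; omega
  | succ k ih =>
    intro b hb hlt
    have hnext := ih ⟨(b : ℕ) + 1, by omega⟩ (by simp only; omega) (by simp only; omega)
    rcases hs b with h | h | h
    · exact absurd (coupling_unique σ lam hs (by omega) h.1 ht₀ hj₀) (fun e => by subst e; omega)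
    · omega
    · rcases h with ⟨h1, _, h3 | h3⟩
      · exact ⟨by omega, h3.2⟩
      · exfalso
        have heq : σ b = σ ⟨(b : ℕ) + 1, by omega⟩ := Fin.ext (by simp only at hnext ⊢; omega)
        have := congrArg Fin.val (σ.injective heq)
        simp only at this
        omega

/-- c-columns up to the hole are shifted down (X-row `b−N−1`, class `2`). -/
theorem below_hole : ∀ (k : ℕ) (b : Fin (2 * N + 1)), (b : ℕ) + k = N + ((σ t₀ : Fin (2 * N + 1)) : ℕ) →
    N < (b : ℕ) → ((σ b : Fin (2 * N + 1)) : ℕ) + 1 = (b : ℕ) - N ∧ lam b = 2 := by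
  intro k
  induction k with
  | zero =>
    intro b hb hlt
    rcases hs b with h | h | h
    · omega
    · rcases h with ⟨h1, _, h3 | h3⟩
      · -- `σ b = b − N = σ t₀`: contradicts injectivity (`b ≠ t₀`)
        exfalso
        have heq : σ b = σ t₀ := Fin.ext (by omega)
        have := congrArg Fin.val (σ.injective heq)
        omega
      · exact ⟨h3.1, h3.2⟩
    · omega
  | succ k ih =>
    intro b hb hlt
    have hnext := ih ⟨(b : ℕ) + 1, by omega⟩ (by simp only; omega) (by simp only; omega)
    rcases hs b with h | h | h
    · omega
    · rcases h with ⟨h1, _, h3 | h3⟩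
      · exfalso
        have heq : σ b = σ ⟨(b : ℕ) + 1, by omega⟩ := Fin.ext (by simp only at hnext ⊢; omega)
        have := congrArg Fin.val (σ.injective heq)
        simp only at this
        omega
      · exact ⟨h3.1, h3.2⟩
    · omega

/-- c-columns beyond the hole are unshifted (X-row `b−N`, class `0`). -/
theorem above_hole : ∀ (n : ℕ) (b : Fin (2 * N + 1)), (b : ℕ) = N + ((σ t₀ : Fin (2 * N + 1)) : ℕ) + 1 + n →
    ((σ b : Fin (2 * N + 1)) : ℕ) = (b : ℕ) - N ∧ lam b = 0 := by
  intro n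
  induction n with
  | zero =>
    intro b hb
    rcases hs b with h | h | h
    · omega
    · rcases h with ⟨h1, _, h3 | h3⟩
      · exact ⟨h3.1, h3.2⟩
      · exfalso
        have heq : σ b = σ t₀ := Fin.ext (by omega)
        have := congrArg Fin.val (σ.injective heq)
        omega
    · omega
  | succ n ih =>
    intro b hb
    have hprev := ih ⟨(b : ℕ) - 1, by omega⟩ (by simp only; omega)
    rcases hs b with h | h | h
    · omega
    · rcases h with ⟨h1, _, h3 | h3⟩
      · exact ⟨h3.1, h3.2⟩
      · exfalso
        have heq : σ b = σ ⟨(b : ℕ) - 1, by omega⟩ := Fin.ext (by simp only at hprev ⊢; omega)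
        have := congrArg Fin.val (σ.injective heq)
        simp only at this
        omega
    · omega

/-- all columns: the row and the class of a present term are those of the state `(σ t₀, t₀)`. -/
theorem row_and_cls_eq (b : Fin (2 * N + 1)) :
    ((σ b : Fin (2 * N + 1)) : ℕ) = rowNat N (σ t₀) t₀ b ∧ lam b = clsNat N (σ t₀) t₀ b := by
  have hb := b.isLt
  unfold rowNat clsNat
  by_cases h1 : (b : ℕ) ≤ N
  · rw [if_pos h1, if_pos h1]
    by_cases h2 : (b : ℕ) = t₀
    · have hbt : b = t₀ := Fin.ext h2
      subst hbt
      rw [if_pos rfl, if_neg (lt_irrefl _)]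
      refine ⟨rfl, ?_⟩
      rcases hs b with h | h | h
      · exact h.2.2
      · omega
      · omega
    · rw [if_neg h2]
      by_cases h3 : (b : ℕ) < t₀
      · rw [if_pos h3, if_pos h3]
        exact left_of_coupling hs ht₀ hj₀ b b rfl h3
      · rw [if_neg h3, if_neg h3]
        exact right_of_coupling hs ht₀ hj₀ (N - b) b (by omega) (by omega)
  · rw [if_neg h1, if_neg h1]
    by_cases h2 : (b : ℕ) - N ≤ ((σ t₀ : Fin (2 * N + 1)) : ℕ)
    · rw [if_pos h2, if_pos h2]
      have := below_hole hs ht₀ hj₀ (N + ((σ t₀ : Fin (2 * N + 1)) : ℕ) - b) b (by omega) (by omega)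
      omega
    · rw [if_neg h2, if_neg h2]
      exact above_hole hs ht₀ hj₀ ((b : ℕ) - (N + ((σ t₀ : Fin (2 * N + 1)) : ℕ) + 1)) b (by omega)

end Rigid

/-- **Rigidity.**  Every present term of the coupled-register design is one of the `(N+1)²` states. -/
theorem rigid (q : Equiv.Perm (Fin (2 * N + 1)) × (Fin (2 * N + 1) → Fin 3)) (hq : termSign (ε N) q ≠ 0) :
    ∃ j t : Fin (N + 1), q = state N j t := by
  have hs := inSupp_of_termSign_ne_zero N hq
  obtain ⟨t₀, ht₀, hj₀⟩ := exists_coupling q.1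
  refine ⟨⟨q.1 t₀, Nat.lt_succ_of_le hj₀⟩, ⟨t₀, Nat.lt_succ_of_le ht₀⟩, ?_⟩
  have key := fun b => row_and_cls_eq hs ht₀ hj₀ b
  unfold state
  refine Prod.ext (Equiv.ext fun b => Fin.ext ?_) (funext fun b => ?_)
  · simp only [perm_apply, rowFin_val]
    exact (key b).1
  · simp only [cls]
    exact (key b).2
/-! ## 6. The chain `k ↦ σ_{k / (N+1), k % (N+1)}` and the lower bounds -/

/-- recombining the digits of the chain index. -/
theorem digits_eq (k : Fin (N * N + 2 * N + 1)) : (N + 1) * ((k : ℕ) / (N + 1)) + (k : ℕ) % (N + 1) = k :=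
  Nat.div_add_mod k (N + 1)

/-- slopes of the chain: `0, 1, 2, …, (N+1)² − 1`. -/
theorem slope_chain (k : Fin (N * N + 2 * N + 1)) : TropicalCensus.slope (d N) (chain N k) = (k : ℕ) := by
  unfold chain
  rw [slope_state]
  simp only [digits_eq]

/-- valuations of the chain: the parabola `k²`. -/
theorem val_chain (k : Fin (N * N + 2 * N + 1)) :
    ∑ i, v N ((chain N k).1 i) i ((chain N k).2 i) = ((k : ℕ) : ℤ) ^ 2 + 0 := by
  unfold chain
  rw [val_state, add_zero]
  simp only [digits_eq]

/-- term signs of the chain: `(−1)^k`. -/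
theorem termSign_chain (k : Fin (N * N + 2 * N + 1)) : termSign (ε N) (chain N k) = (-1) ^ (k : ℕ) := by
  unfold chain
  rw [termSign_state]
  simp only [digits_eq]

/-- consecutive chain terms have opposite signs. -/
theorem chain_alternates (k : Fin (N * N + 2 * N)) :
    termSign (ε N) (chain N k.castSucc) * termSign (ε N) (chain N k.succ) < 0 := by
  rw [termSign_chain, termSign_chain, Fin.val_castSucc, Fin.val_succ, ← pow_add,
    show (k : ℕ) + ((k : ℕ) + 1) = 2 * (k : ℕ) + 1 by ring, pow_succ, pow_mul]
  norm_num

/-- every present term is a chain term. -/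
theorem eq_chain_of_present (q : Equiv.Perm (Fin (2 * N + 1)) × (Fin (2 * N + 1) → Fin 3))
    (hq : termSign (ε N) q ≠ 0) : ∃ k, q = chain N k := by
  obtain ⟨j, t, rfl⟩ := rigid N q hq
  have hj := j.isLt
  have ht := t.isLt
  refine ⟨⟨(N + 1) * (j : ℕ) + (t : ℕ), by nlinarith⟩, ?_⟩
  unfold chain
  have h1 : ((N + 1) * (j : ℕ) + (t : ℕ)) / (N + 1) = j := by
    rw [Nat.mul_add_div (Nat.succ_pos N), Nat.div_eq_of_lt ht, add_zero]
  have h2 : ((N + 1) * (j : ℕ) + (t : ℕ)) % (N + 1) = t := by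
    rw [Nat.mul_add_mod, Nat.mod_eq_of_lt ht]
  congr 1
  · exact Fin.ext h1.symm
  · exact Fin.ext h2.symm

/-- **The chain is dominant** at the explicit integer slopes of the parabola criterion. -/
theorem exists_dominant_chain :
    ∃ θ : Fin (N * N + 2 * N + 1) → ℤ, StrictMono θ ∧ ∀ k, IsDominant (d N) (v N) (ε N) (θ k) (chain N k) := by
  refine isDominant_of_parabola (d N) (v N) (ε N) (chain N) (fun k => ((k : ℕ) : ℤ)) 0 1 1
    (slope_chain N) ?_ ?_ (fun k => ?_) (val_chain N) ?_ (by norm_num) (by norm_num)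
  · intro a b hab
    show ((a : ℕ) : ℤ) < ((b : ℕ) : ℤ)
    exact_mod_cast hab
  · intro k
    simp only [Fin.val_succ, Fin.val_castSucc]
    push_cast
    exact le_rfl
  · rw [termSign_chain]; exact pow_ne_zero _ (by norm_num)
  · intro q hq hne
    obtain ⟨k, rfl⟩ := eq_chain_of_present N q hq
    exact absurd rfl (hne k)

/-- **Lower bound (general capacity)**: `¬ TropRootLawAt (2N+1) 3 B` for `B < N² + 2N`. -/
theorem not_tropRootLawAt {B : ℕ} (hB : B < N * N + 2 * N) : ¬ TropRootLawAt (2 * N + 1) 3 B := by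
  obtain ⟨θ, hθ, hdom⟩ := exists_dominant_chain N
  intro h
  have := h (d N) (v N) (ε N) (N * N + 2 * N) θ (chain N) (natAbs_ε_le N) hθ hdom (chain_alternates N)
  omega

/-- **Lower bound (static capacity)**: `¬ TropRootLawAtStatic (2N+1) 3 B` for `B < N² + 2N` — the design is static. -/
theorem not_tropRootLawAtStatic {B : ℕ} (hB : B < N * N + 2 * N) : ¬ TropRootLawAtStatic (2 * N + 1) 3 B := by
  obtain ⟨θ, hθ, hdom⟩ := exists_dominant_chain N
  intro h
  have := h (d N) (v N) (ε N) (N * N + 2 * N) θ (chain N) (natAbs_ε_le N) (isStatic N) hθ hdom (chain_alternates N)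
  omega

end CoupledRegister

/-- **Static `K = 3` capacity is at least `(N+1)² − 1` on `2N+1` nodes.**  `TropRootLawAtStatic (2N+1) 3 B → N² + 2N ≤ B`:
plain 3-slope parametric ASSIGNMENT instances of odd size `M` admit `((M+1)/2)² − 1` sign-alternating dominant breakpoints
(coupled registers; counting ceiling `C(M+2,2) − 1`). -/
theorem sq_le_of_tropRootLawAtStatic_coupledRegister (N : ℕ) {B : ℕ} (h : TropRootLawAtStatic (2 * N + 1) 3 B) :
    N * N + 2 * N ≤ B := by
  by_contra hlt
  exact CoupledRegister.not_tropRootLawAtStatic N (by omega) h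

/-- the same for the general tropical row `TropRootLawAt (2N+1) 3 B` (δ-equal to the birth file's `TropRow`). -/
theorem sq_le_of_tropRootLawAt_coupledRegister (N : ℕ) {B : ℕ} (h : TropRootLawAt (2 * N + 1) 3 B) :
    N * N + 2 * N ≤ B := by
  by_contra hlt
  exact CoupledRegister.not_tropRootLawAt N (by omega) h

end Summit.ValiantsHypothesis.ValiantsHypothesis.Theorems.KPlusLogSqLaw
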